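import Summits.SmoothPoincare4.SmoothPoincare4.Theorems.HeegaardHandlebodyCongruenceClosed.Negative.MixingTwists

/-!
# `HeegaardHandlebodyCongruenceClosed` — negative-side support (5/5): a Johnson-kernel witness

`ρ₂ = ψ ∘ T_{δ₀} ∘ ψ⁻¹` (`ψ = T_B ∘ T_A⁻¹`) is a genus-1 separating twist of `S₃` which
(i) lies in the JOHNSON KERNEL — `ρ₂ s · s⁻¹ ∈ γ₃(S₃)` for every `s` (`rho2_congr_gamma3`), a fortiori in
the Torelli group — and (ii) is NOT in the gate `(A∩B)·C` (`not_inGate_rho2`: certificate `cert2` into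
`Sym(3)` through the pair `(N₀, ρ₂N₂)`, evaluated by pushing the hom through the five factors,
`st1_… … st5_…`). Consequences, the refuted strengthenings 4–6 of the crux:
`heegaardHandlebodyCongruenceClosed_false_with_torelli_congruence`, `…_johnson_congruence`,
`…_classTwo_levels` — the crux hypothesis over ALL abelian and ALL class-2-nilpotent levels does not
imply its conclusion; any proof must use levels of nilpotency class ≥ 3 or non-nilpotent ones.
[folklore]
-/

namespace Summit.SmoothPoincare4.SmoothPoincare4.Theorems.HeegaardHandlebodyCongruenceClosed.Negative

open Literature.Topology.FourManifolds Subgroup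

section GenusThree

open SurfaceGroup
open Summit.SmoothPoincare4.SmoothPoincare4.Theorems.ShadowApproximation.Negative
  (surfaceRelator_three of_eq_a of_eq_b rel_three lift_surfaceRelator_three liftHom liftHom_of
    liftHom_a liftHom_b)
open scoped commutatorElement

/-- `ψ = T_B ∘ T_A⁻¹` [folklore] -/
def psi : SurfaceGroup 3 ≃* SurfaceGroup 3 := TA.symm.trans TB

/-- **`ρ₂ = ψ ∘ T_{δ₀} ∘ ψ⁻¹ = T_{ψ(δ₀)}`**: the Dehn twist about the genus-1 separating curve
`ψ(∂ handle 0)`. It lies in the JOHNSON KERNEL (acts trivially on `S₃/γ₃S₃`, `rho2_congr_gamma3`),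
in particular in the Torelli group, yet `ρ₂ ∉ (A∩B)·C` (`not_inGate_rho2`): the 3-manifold
`H_{N₀} ∪ H_{ρ₂N₂}` is a homology `S¹×S²` whose group maps onto `Sym(3)`. [folklore] -/
def rho2 : SurfaceGroup 3 ≃* SurfaceGroup 3 := (psi.symm.trans P0).trans psi

/-- helper lemma `rho2_apply` (see the module docstring). [folklore] -/
theorem rho2_apply (s : SurfaceGroup 3) : rho2 s = TB (TA.symm (P0 (TA (TB.symm s)))) := by
  simp [rho2, psi]

/-! ### Certificate for `ρ₂` via the pair `(N₀, ρ₂N₂)`: `b₀ ↦ (0 1 2)`, `b₁ ↦ (1 2)`, others `↦ 1` -/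

/-- generator images of the certificate hom for `ρ₂` [folklore] -/
def cert2Fun (p : surfaceGen 3) : Equiv.Perm (Fin 3) :=
  if p = (0, true) then finRotate 3 else if p = (1, true) then Equiv.swap 1 2 else 1

/-- helper lemma `cert2Fun_rel` (see the module docstring). [folklore] -/
theorem cert2Fun_rel : FreeGroup.lift cert2Fun (surfaceRelator 3) = 1 := by
  rw [lift_surfaceRelator_three]; simp [cert2Fun]

/-- certificate hom for `ρ₂` [folklore] -/
def cert2 : SurfaceGroup 3 →* Equiv.Perm (Fin 3) := liftHom cert2Fun cert2Fun_rel

/-- helper lemma `cert2_a0` (see the module docstring). [folklore] -/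
@[simp] theorem cert2_a0 : cert2 (a 0) = 1 := by simp [cert2, cert2Fun]
/-- helper lemma `cert2_b0` (see the module docstring). [folklore] -/
@[simp] theorem cert2_b0 : cert2 (b 0) = finRotate 3 := by simp [cert2, cert2Fun]
/-- helper lemma `cert2_a1` (see the module docstring). [folklore] -/
@[simp] theorem cert2_a1 : cert2 (a 1) = 1 := by simp [cert2, cert2Fun]
/-- helper lemma `cert2_b1` (see the module docstring). [folklore] -/
@[simp] theorem cert2_b1 : cert2 (b 1) = Equiv.swap 1 2 := by simp [cert2, cert2Fun]
/-- helper lemma `cert2_a2` (see the module docstring). [folklore] -/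
@[simp] theorem cert2_a2 : cert2 (a 2) = 1 := by simp [cert2, cert2Fun]
/-- helper lemma `cert2_b2` (see the module docstring). [folklore] -/
@[simp] theorem cert2_b2 : cert2 (b 2) = 1 := by simp [cert2, cert2Fun]

/-- helper lemma `st1_a0` (see the module docstring). [folklore] -/
theorem st1_a0 : cert2 (TB (a 0)) = Equiv.swap 0 2 := by
  simp only [TB_a0, map_mul, cert2_a0, cert2_b1, cert2_b0]
  decide
/-- helper lemma `st1_b0` (see the module docstring). [folklore] -/
theorem st1_b0 : cert2 (TB (b 0)) = (finRotate 3)⁻¹ := by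
  simp only [TB_b0, map_mul, map_inv, cert2_b0, cert2_b1]
  decide
/-- helper lemma `st1_a1` (see the module docstring). [folklore] -/
theorem st1_a1 : cert2 (TB (a 1)) = Equiv.swap 1 2 := by
  simp only [TB_a1, map_mul, map_inv, cert2_b0, cert2_b1, cert2_a1]
  decide
/-- helper lemma `st1_b1` (see the module docstring). [folklore] -/
theorem st1_b1 : cert2 (TB (b 1)) = Equiv.swap 0 1 := by
  simp only [TB_b1, map_mul, map_inv, cert2_b0, cert2_b1]
  decide
/-- helper lemma `st1_a2` (see the module docstring). [folklore] -/
theorem st1_a2 : cert2 (TB (a 2)) = 1 := by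
  simp only [TB_a2, cert2_a2]
/-- helper lemma `st1_b2` (see the module docstring). [folklore] -/
theorem st1_b2 : cert2 (TB (b 2)) = 1 := by
  simp only [TB_b2, cert2_b2]

/-- helper lemma `st2_a0` (see the module docstring). [folklore] -/
theorem st2_a0 : cert2 (TB (TA.symm (a 0))) = Equiv.swap 1 2 := by
  simp only [TA_symm_a0, map_mul, map_inv, st1_a0, st1_a1]
  decide
/-- helper lemma `st2_b0` (see the module docstring). [folklore] -/
theorem st2_b0 : cert2 (TB (TA.symm (b 0))) = finRotate 3 := by
  simp only [TA_symm_b0, map_mul, map_inv, st1_a0, st1_a1, st1_b0]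
  decide
/-- helper lemma `st2_a1` (see the module docstring). [folklore] -/
theorem st2_a1 : cert2 (TB (TA.symm (a 1))) = Equiv.swap 0 1 := by
  simp only [TA_symm_a1, map_mul, map_inv, st1_a0, st1_a1]
  decide
/-- helper lemma `st2_b1` (see the module docstring). [folklore] -/
theorem st2_b1 : cert2 (TB (TA.symm (b 1))) = Equiv.swap 1 2 := by
  simp only [TA_symm_b1, map_mul, map_inv, st1_b1, st1_a1, st1_a0]
  decide
/-- helper lemma `st2_a2` (see the module docstring). [folklore] -/
theorem st2_a2 : cert2 (TB (TA.symm (a 2))) = 1 := by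
  simp only [TA_symm_a2, st1_a2]
/-- helper lemma `st2_b2` (see the module docstring). [folklore] -/
theorem st2_b2 : cert2 (TB (TA.symm (b 2))) = 1 := by
  simp only [TA_symm_b2, st1_b2]

/-- helper lemma `st3_a0` (see the module docstring). [folklore] -/
theorem st3_a0 : cert2 (TB (TA.symm (P0 (a 0)))) = Equiv.swap 0 2 := by
  simp only [P0_a0, map_mul, map_inv, st2_a0, st2_b0]
  decide
/-- helper lemma `st3_b0` (see the module docstring). [folklore] -/
theorem st3_b0 : cert2 (TB (TA.symm (P0 (b 0)))) = finRotate 3 := by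
  simp only [P0_b0, map_mul, map_inv, st2_a0, st2_b0]
  decide
/-- helper lemma `st3_a1` (see the module docstring). [folklore] -/
theorem st3_a1 : cert2 (TB (TA.symm (P0 (a 1)))) = Equiv.swap 0 1 := by
  simp only [P0_a1, st2_a1]
/-- helper lemma `st3_b1` (see the module docstring). [folklore] -/
theorem st3_b1 : cert2 (TB (TA.symm (P0 (b 1)))) = Equiv.swap 1 2 := by
  simp only [P0_b1, st2_b1]
/-- helper lemma `st3_a2` (see the module docstring). [folklore] -/
theorem st3_a2 : cert2 (TB (TA.symm (P0 (a 2)))) = 1 := by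
  simp only [P0_a2, st2_a2]
/-- helper lemma `st3_b2` (see the module docstring). [folklore] -/
theorem st3_b2 : cert2 (TB (TA.symm (P0 (b 2)))) = 1 := by
  simp only [P0_b2, st2_b2]

/-- helper lemma `st4_a0` (see the module docstring). [folklore] -/
theorem st4_a0 : cert2 (TB (TA.symm (P0 (TA (a 0))))) = Equiv.swap 1 2 := by
  simp only [TA_a0, map_mul, map_inv, st3_a1, st3_a0]
  decide
/-- helper lemma `st4_b0` (see the module docstring). [folklore] -/
theorem st4_b0 : cert2 (TB (TA.symm (P0 (TA (b 0))))) = 1 := by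
  simp only [TA_b0, map_mul, map_inv, st3_a1, st3_a0, st3_b0]
  decide
/-- helper lemma `st4_a1` (see the module docstring). [folklore] -/
theorem st4_a1 : cert2 (TB (TA.symm (P0 (TA (a 1))))) = Equiv.swap 0 2 := by
  simp only [TA_a1, map_mul, map_inv, st3_a1, st3_a0]
  decide
/-- helper lemma `st4_b1` (see the module docstring). [folklore] -/
theorem st4_b1 : cert2 (TB (TA.symm (P0 (TA (b 1))))) = Equiv.swap 0 2 := by
  simp only [TA_b1, map_mul, st3_b1, st3_a0, st3_a1]
  decide
/-- helper lemma `st4_a2` (see the module docstring). [folklore] -/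
theorem st4_a2 : cert2 (TB (TA.symm (P0 (TA (a 2))))) = 1 := by
  simp only [TA_a2, st3_a2]
/-- helper lemma `st4_b2` (see the module docstring). [folklore] -/
theorem st4_b2 : cert2 (TB (TA.symm (P0 (TA (b 2))))) = 1 := by
  simp only [TA_b2, st3_b2]

/-- helper lemma `st5_a0` (see the module docstring). [folklore] -/
theorem st5_a0 : cert2 (TB (TA.symm (P0 (TA (TB.symm (a 0)))))) = finRotate 3 := by
  simp only [TB_symm_a0, map_mul, map_inv, st4_a0, st4_b0, st4_b1]
  decide
/-- helper lemma `st5_b0` (see the module docstring). [folklore] -/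
theorem st5_b0 : cert2 (TB (TA.symm (P0 (TA (TB.symm (b 0)))))) = 1 := by
  simp only [TB_symm_b0, map_mul, map_inv, st4_b1, st4_b0]
  decide
/-- helper lemma `st5_a1` (see the module docstring). [folklore] -/
theorem st5_a1 : cert2 (TB (TA.symm (P0 (TA (TB.symm (a 1)))))) = 1 := by
  simp only [TB_symm_a1, map_mul, map_inv, st4_b1, st4_b0, st4_a1]
  decide
/-- helper lemma `st5_b1` (see the module docstring). [folklore] -/
theorem st5_b1 : cert2 (TB (TA.symm (P0 (TA (TB.symm (b 1)))))) = Equiv.swap 0 2 := by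
  simp only [TB_symm_b1, map_mul, map_inv, st4_b1, st4_b0]
  decide
/-- helper lemma `st5_a2` (see the module docstring). [folklore] -/
theorem st5_a2 : cert2 (TB (TA.symm (P0 (TA (TB.symm (a 2)))))) = 1 := by
  simp only [TB_symm_a2, st4_a2]
/-- helper lemma `st5_b2` (see the module docstring). [folklore] -/
theorem st5_b2 : cert2 (TB (TA.symm (P0 (TA (TB.symm (b 2)))))) = 1 := by
  simp only [TB_symm_b2, st4_b2]

/-! ### `ρ₂` is not in the gate -/

/-- at genus 3, a hom killing `a₀, b₀, a₁, a₂, b₂` (i.e. `N₀ ⊔ N₂`) has abelian image [folklore] -/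
theorem commute_of_kills0 {Q : Type*} [Group Q] (φ : SurfaceGroup 3 →* Q)
    (h1 : φ (a 0) = 1) (h2 : φ (b 0) = 1) (h3 : φ (a 1) = 1) (h4 : φ (a 2) = 1) (h5 : φ (b 2) = 1)
    (s t : SurfaceGroup 3) : φ s * φ t = φ t * φ s := by
  let ε : SurfaceGroup 3 →* Multiplicative ℤ :=
    SurfaceGroup.toCommGroup (fun p => if p = ((1 : Fin 3), true) then Multiplicative.ofAdd 1 else 1)
  have hφ : φ = (zpowersHom Q (φ (b 1))).comp ε := by
    apply PresentedGroup.ext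
    rintro ⟨i, _ | _⟩ <;> fin_cases i <;>
      simp [ε, of_eq_a, of_eq_b, h1, h2, h3, h4, h5]
  rw [hφ]
  simp only [MonoidHom.comp_apply, zpowersHom_apply]
  exact zpow_mul_comm _ _ _

/-- helper lemma `a_mem_s4Kernels_zero` (see the module docstring). [folklore] -/
theorem a_mem_s4Kernels_zero : (a 0 : SurfaceGroup 3) ∈ s4Kernels 0 :=
  subset_normalClosure (by simp)
/-- helper lemma `a_one_mem_s4Kernels_zero` (see the module docstring). [folklore] -/
theorem a_one_mem_s4Kernels_zero : (a 1 : SurfaceGroup 3) ∈ s4Kernels 0 :=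
  subset_normalClosure (by simp)
/-- helper lemma `b_two_mem_s4Kernels_zero` (see the module docstring). [folklore] -/
theorem b_two_mem_s4Kernels_zero : (b 2 : SurfaceGroup 3) ∈ s4Kernels 0 :=
  subset_normalClosure (by simp)

/-- **Non-gate certificate via the pair `(N₀, ρN₂)` (genus 3).** A hom `f : S₃ → Q` killing the
generators `a₀, a₁, b₂` of `N₀` and `ρ b₀, ρ a₁, ρ a₂` of `ρ N₂`, with two non-commuting values,
shows `ρ ∉ (Stab N₀ ∩ Stab N₁)·Stab N₂` (as `S₃ ⧸ (N₀ ⊔ N₂) = ⟨b₁⟩ ≅ ℤ` is abelian). [folklore] -/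
theorem not_inGate_zero_of_cert0 {Q : Type*} [Group Q] (ρ : SurfaceGroup 3 ≃* SurfaceGroup 3)
    (f : SurfaceGroup 3 →* Q) (hf0 : f (a 0) = 1) (hf1 : f (a 1) = 1) (hf2 : f (b 2) = 1)
    (hρ0 : f (ρ (b 0)) = 1) (hρ1 : f (ρ (a 1)) = 1) (hρ2 : f (ρ (a 2)) = 1)
    (s t : SurfaceGroup 3) (hne : f s * f t ≠ f t * f s) : ρ ∉ gate 0 := by
  intro h
  obtain ⟨x, h0, -, h2⟩ := (inGate_iff 0 ρ).1 h
  change (s4Kernels 0).map x.toMonoidHom = s4Kernels 0 at h0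
  change (s4Kernels 2).map x.toMonoidHom = (s4Kernels 2).map ρ.toMonoidHom at h2
  have k0 : s4Kernels 0 ≤ f.ker := by
    refine normalClosure_le_normal ?_
    rintro _ (rfl | rfl | rfl) <;> simpa
  have k2 : (s4Kernels 2).map ρ.toMonoidHom ≤ f.ker := by
    rw [show s4Kernels 2 = normalClosure {b 0, a 1, a 2} from rfl, map_normalClosure _ _ ρ.surjective]
    refine normalClosure_le_normal ?_
    rintro _ ⟨_, (rfl | rfl | rfl), rfl⟩ <;> simpa
  have viaN0 : ∀ g ∈ s4Kernels 0, f (x g) = 1 := fun g hg =>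
    k0 (h0.le (mem_map_of_mem x.toMonoidHom hg))
  have viaN2 : ∀ g ∈ s4Kernels 2, f (x g) = 1 := fun g hg =>
    k2 (h2.le (mem_map_of_mem x.toMonoidHom hg))
  have comm := commute_of_kills0 (f.comp x.toMonoidHom)
    (viaN0 _ a_mem_s4Kernels_zero) (viaN2 _ b_mem_s4Kernels_two) (viaN0 _ a_one_mem_s4Kernels_zero)
    (viaN2 _ a_two_mem_s4Kernels_two) (viaN0 _ b_two_mem_s4Kernels_zero) (x.symm s) (x.symm t)
  exact hne (by simpa using comm)

/-- **`ρ₂ ∉ (A∩B)·C`** (certificate `cert2` into `Sym(3)`). [folklore] -/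
theorem not_inGate_rho2 : rho2 ∉ gate 0 := by
  refine not_inGate_zero_of_cert0 rho2 cert2 cert2_a0 cert2_a1 cert2_b2 ?_ ?_ ?_ (b 0) (b 1) ?_
  · rw [rho2_apply]; exact st5_b0
  · rw [rho2_apply]; exact st5_a1
  · rw [rho2_apply]; exact st5_a2
  · rw [cert2_b0, cert2_b1]; decide

/-! ### `ρ₂` lies in the Johnson kernel: `ρ₂ ≡ id (mod γ₃ S₃)` -/

/-- `γ₃(S₃) = [[S₃,S₃],S₃]`, the third term of the lower central series. [folklore] -/
abbrev Gamma3 : Subgroup (SurfaceGroup 3) := (⊤ : Subgroup (SurfaceGroup 3)).lowerCentralSeries 2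

/-- `T_{δ₀}` acts trivially modulo `γ₃`: `T_{δ₀}(g) g⁻¹ = [δ₀, g] ∈ [γ₂, S₃]`. [folklore] -/
theorem p0_congr_gamma3 (s : SurfaceGroup 3) : P0 s * s⁻¹ ∈ Gamma3 := by
  suffices h : (QuotientGroup.mk' Gamma3).comp P0.toMonoidHom = QuotientGroup.mk' Gamma3 by
    have := DFunLike.congr_fun h s
    simp only [MonoidHom.comp_apply, MulEquiv.coe_toMonoidHom, QuotientGroup.mk'_apply] at this
    rw [QuotientGroup.eq_iff_div_mem, div_eq_mul_inv] at this
    exact this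
  have hδ : ⁅(a 0 : SurfaceGroup 3), (b 0 : SurfaceGroup 3)⁆ ∈
      (⊤ : Subgroup (SurfaceGroup 3)).lowerCentralSeries 1 :=
    Subgroup.commutator_mem_commutator (Subgroup.mem_top (a 0 : SurfaceGroup 3))
      (Subgroup.mem_top (b 0 : SurfaceGroup 3))
  have ha : P0 (a 0) / a 0 ∈ Gamma3 := by
    have e : P0 (a 0) / a 0 =
        ⁅⁅(a 0 : SurfaceGroup 3), (b 0 : SurfaceGroup 3)⁆, (a 0 : SurfaceGroup 3)⁆ := by
      rw [P0_a0]
      simp only [commutatorElement_def, div_eq_mul_inv]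
      group
    rw [e]
    exact Subgroup.commutator_mem_commutator hδ (Subgroup.mem_top _)
  have hb : P0 (b 0) / b 0 ∈ Gamma3 := by
    have e : P0 (b 0) / b 0 =
        ⁅⁅(a 0 : SurfaceGroup 3), (b 0 : SurfaceGroup 3)⁆, (b 0 : SurfaceGroup 3)⁆ := by
      rw [P0_b0]
      simp only [commutatorElement_def, div_eq_mul_inv]
      group
    rw [e]
    exact Subgroup.commutator_mem_commutator hδ (Subgroup.mem_top _)
  apply PresentedGroup.ext
  rintro ⟨i, _ | _⟩ <;> fin_cases i <;>
    simp only [MonoidHom.comp_apply, MulEquiv.coe_toMonoidHom, QuotientGroup.mk'_apply,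
      QuotientGroup.eq_iff_div_mem] <;>
    simp [of_eq_a, of_eq_b]
  · simpa using ha
  · simpa using hb

/-- conjugation transports pointwise congruence modulo a characteristic subgroup [folklore] -/
theorem congr_conj {Γ : Subgroup (SurfaceGroup 3)} [hΓ : Γ.Characteristic]
    (P φ : SurfaceGroup 3 ≃* SurfaceGroup 3) (hP : ∀ t, P t * t⁻¹ ∈ Γ) (s : SurfaceGroup 3) :
    φ (P (φ.symm s)) * s⁻¹ ∈ Γ := by
  have h := hP (φ.symm s)
  have e : φ (P (φ.symm s)) * s⁻¹ = φ (P (φ.symm s) * (φ.symm s)⁻¹) := by simp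
  rw [e]
  have hmap : Γ.map φ.toMonoidHom = Γ := Subgroup.characteristic_iff_map_eq.1 hΓ φ
  exact hmap.le (Subgroup.mem_map_of_mem φ.toMonoidHom h)

/-- **`ρ₂` is in the Johnson kernel**: `ρ₂ s · s⁻¹ ∈ γ₃(S₃)` for every `s`. [folklore] -/
theorem rho2_congr_gamma3 (s : SurfaceGroup 3) : rho2 s * s⁻¹ ∈ Gamma3 :=
  congr_conj (Γ := Gamma3) P0 psi p0_congr_gamma3 s

/-- hence `ρ₂` is in the Torelli group: `ρ₂ s · s⁻¹ ∈ [S₃,S₃]`. [folklore] -/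
theorem rho2_congr_commutator (s : SurfaceGroup 3) : rho2 s * s⁻¹ ∈ commutator (SurfaceGroup 3) := by
  have h : Gamma3 ≤ (⊤ : Subgroup (SurfaceGroup 3)).lowerCentralSeries 1 :=
    Subgroup.lowerCentralSeries_antitone ⊤ (by norm_num : 1 ≤ 2)
  exact h (rho2_congr_gamma3 s)

/-! ### Refuted natural strengthenings of the crux (II): all abelian / all class-2 levels at once -/

/-- STRENGTHENING 4 REFUTED (Torelli): congruence modulo the commutator subgroup — i.e. modulo EVERY
abelian level simultaneously — does not force gate membership (`ρ₂`, a separating twist). Compare: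
the abelian SHADOW statement is true (class number one in `GSp₆(ℤ)`). [folklore] -/
theorem heegaardHandlebodyCongruenceClosed_false_with_torelli_congruence :
    ¬ ∀ ρ : SurfaceGroup 3 ≃* SurfaceGroup 3, (∀ s, ρ s * s⁻¹ ∈ commutator (SurfaceGroup 3)) →
        ρ ∈ gate 0 := fun h =>
  not_inGate_rho2 (h rho2 rho2_congr_commutator)

/-- STRENGTHENING 5 REFUTED (Johnson kernel): congruence modulo `γ₃(S₃)` — i.e. modulo EVERY level
with class-2 nilpotent quotient simultaneously — does not force gate membership. [folklore] -/
theorem heegaardHandlebodyCongruenceClosed_false_with_johnson_congruence :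
    ¬ ∀ ρ : SurfaceGroup 3 ≃* SurfaceGroup 3,
        (∀ s, ρ s * s⁻¹ ∈ (⊤ : Subgroup (SurfaceGroup 3)).lowerCentralSeries 2) → ρ ∈ gate 0 := fun h =>
  not_inGate_rho2 (h rho2 rho2_congr_gamma3)

/-- STRENGTHENING 6 REFUTED (level form, the crux restricted to class-≤2 levels): the hypothesis of
the crux over all characteristic finite-index `M ⊇ γ₃(S₃)` does NOT imply its conclusion (`m = 0`,
witness `ρ₂` with `x = c = 1` at every such level). MORAL: a proof must use levels `M` with `S₃/M` of
nilpotency class ≥ 3 or non-nilpotent. [folklore] -/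
theorem heegaardHandlebodyCongruenceClosed_false_with_classTwo_levels :
    ¬ ∀ ρ : SurfaceGroup 3 ≃* SurfaceGroup 3,
        (∀ M : Subgroup (SurfaceGroup 3), M.Characteristic → M.FiniteIndex →
          (⊤ : Subgroup (SurfaceGroup 3)).lowerCentralSeries 2 ≤ M → ρ ∈ gateMod 0 M) → ρ ∈ gate 0 :=
  fun h => not_inGate_rho2 (h rho2 fun M _ _ hM =>
    ⟨MulEquiv.refl _, MulEquiv.refl _, by simp, by simp, by simp,
      fun s => hM (by simpa using rho2_congr_gamma3 s)⟩)

end GenusThree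

end Summit.SmoothPoincare4.SmoothPoincare4.Theorems.HeegaardHandlebodyCongruenceClosed.Negative
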